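import Literature.NumberTheory.EllipticCurves.Rank1Residual.Typed.WuthrichUpperBound
import Literature.NumberTheory.EllipticCurves.Rank1Residual.ClassX1
import HarnessLib

/-!
# Class X1 (Eisenstein ANOMALOUS good `p`) — the residual part, TYPED (cell `b2b-bsdres`, prover B)

HONEST FRAMING (run/shared/lean/b2b/bsd-rank1-residual/): the cell deletes COMBINATION-shaped
residual classes of the analytic-rank-`≤ 1` BSD formula STRICTLY from published theorems and TYPES
what is left — the missing input is named and its required output at `(E,p)` stated, NOT attempted,
no preprint used; this is not "finishing BSD". This file is the typed companion of
`Rank1Residual/ClassX1.lean` (the published sub-class theorems of class X1) in the vocabulary of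
`Rank1Residual/Typed/Basic.lean` (`MissingLowerBoundAt`, `MissingUpperBoundAt`, `MissingPPartAt`),
following the pattern of `Typed/X2.lean`.

**Class X1** (`Rank1Residual.ClassX1 W p := 2 < p ∧ Red W p ∧ Good W p ∧ Anom W p ∧
¬(W.analyticRank = 0 ∧ GVPar W p)`; RESIDUAL-CASES §a.2 v3): e.g. `11a1@5`, `14a1@3`, `26b1@7`;
census v3: 291 pairs with `N < 2500` (165 of rank `0`, 126 of rank `1`), 559 with `N < 10⁴`
(300 / 259). Label at input: COMBINATION-SHAPED (announced: Keller–Yin arXiv:2402.12781v2 Thm. 3).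

**What is in print at an X1 pair** (files `Wuthrich2014/*`, `Rank1Residual/ClassX1.lean`):
(r = 0) the UPPER bound `ord_p #Ш(E/ℚ) ≤ ord_p #Ш(E/ℚ)_an` — Wuthrich, Doc. Math. 19 (2014), Prop. 21
(= his Thm. 16, Kato's divisibility made integral at a reducible prime, + Greenberg LNM 1716 Thm. 4.1
+ Mazur–Swinnerton-Dyer; kernel form `Wuthrich2014.le_padicValRat_of_charIdeal_dvd_padicLFunction`);
hence `BSD(E,p)` whenever `p ∤ #Ш(E')_an` for some `E'` in the `ℚ`-isogeny class (Cassels) — all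
300 rank-`0` census pairs. (r = 1) rank and finiteness (Gross–Zagier–Kolyvagin) and per-curve upper
bounds (Miller–Stoll 2013 `p`-isogeny descent; Stein–Wuthrich 2013 / Wuthrich 2014 §6; Lawson–Wuthrich
2016 Thm. 14) — no class statement.

**What kind of object is missing.** (r = 0) The LOWER bound `ord_p #Ш_an ≤ ord_p #Ш`, i.e. the
Eisenstein-congruence direction `(L_p(E)) ⊆ char_Λ X(E/ℚ_∞)` in `Λ` INCLUDING THE `μ`-PART, at an
anomalous Eisenstein prime of type (unramified-at-`p`, even)/(ramified, odd): Greenberg–Vatsal,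
Invent. Math. 142 (2000) Thm. 1.3 proves `μ = 0` on both sides only for the opposite type
(`gvpar`, the covered class C7), Castella–Grossi–Skinner, Math. Ann. 393 (2025) Thm. A (= Thm. 7.1.1;
arXiv v1 LaTeXML "Thm. 1") only for
`φ|_{G_p} ∉ {1, ω}` (non-anomalous); Keller–Yin prove anticyclotomic statements and assert the
cyclotomic one in prose (§0.5) — UNSTATED as a theorem anywhere (cell files X1-CHAIN.md L10, X1-B.md §2,
REFEREE.md R6.4). (r = 1) The whole `p`-part output: Keller–Yin's rank-one display (their Thm. 3.0.11
anticyclotomic IMC at anomalous `p` + Thm. 7.0.6 control with torsion; PREPRINT) and, for type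
(unramified, odd)/(ramified, even), Mazur's identity for the rank-`0` twist partner (unstated) —
typed with those binders in `Rank1Residual/ClassX1KellerYin.lean` (prover A).

This file: `X1.MissingInputAt` (r = 0: `MissingLowerBoundAt`; r = 1: `MissingPPartAt`), the
conditional class theorem `X1.bsdp_of_missingInputAt` (canonical shape; the rank-`0` upper half supplied
by Wuthrich's Prop. 21), `X1.missingUpperBoundAt_of_classX1` (the published half), and
`X1.missingLowerBoundAt_of_isIsogenous` (the rank-`0` missing input is DISCHARGED in print at every pair
whose isogeny class contains a curve with `p ∤ #Ш_an` — Wuthrich + Cassels). The universally quantified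
"every X1 pair has `MissingInputAt`" is not a Literature statement; it lives in the cell's CLASSES.md.
-/

noncomputable section

open scoped Classical

open WeierstrassCurve Literature.NumberTheory.EllipticCurves
  Literature.NumberTheory.EllipticCurves.Rank1Residual
  Literature.NumberTheory.EllipticCurves.Wuthrich2014

namespace Literature.NumberTheory.EllipticCurves.Rank1Residual.Typed

/-- **X1 — the missing input at `(E, p)`, typed.** For a pair of class X1 (odd good anomalous
Eisenstein prime): in analytic rank `0`, the Eisenstein-congruence direction
`ord_p #Ш(E/ℚ)_an ≤ ord_p #Ш(E/ℚ)` (`MissingLowerBoundAt`; the opposite inequality is Wuthrich 2014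
Prop. 21, in print, `X1.missingUpperBoundAt_of_classX1`); in analytic rank `1`, the whole `p`-part
output `MissingPPartAt` (announced by Keller–Yin 2024 Thm. 3, unrefereed; nothing class-wide in
print). Nothing is asserted: this is the TYPE a future theorem must inhabit at `(E,p)` — a
predicate with free `(W, p)`, consumed only as the last binder of `X1.bsdp_of_missingInputAt`
(referee R7.3; on X1 ∩ {r = 0} it is EQUIVALENT to Mazur's cyclotomic (MC) statement for
`(E, p)` (Néron normalisation) and to `BSDp W p` — x1b-g2's kernel iff, referee audit F20 and
ruling R9.2, in the sibling file of this directory's parent named after X1 and Mazur's (MC)).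
[cite: Wuthrich2014, Prop. 21 (p. 400) (shape only; nothing asserted)]
[cite: KellerYin2024, Thm. 3 = Thm. 4.2.1 (announced statement; shape only; nothing asserted)] -/
def X1.MissingInputAt (W : WeierstrassCurve ℚ) (p : ℕ) : Prop :=
  (W.analyticRank = 0 → MissingLowerBoundAt W p) ∧ (W.analyticRank = 1 → MissingPPartAt W p)

/-- **X1, the published half (rank 0): `MissingUpperBoundAt W p`** — `ord_p #Ш ≤ ord_p #Ш_an` at every
X1 pair of analytic rank `0`, from Wuthrich 2014 Prop. 21 (`hW`; good ⇒ not additive, reducible ⇒ Borel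
image), with Gross–Zagier–Kolyvagin (`hGZK`) and modularity (`hmod`, for `r_an = 0 ⇒ L(E,1) ≠ 0`).
[cite: Wuthrich2014, Prop. 21 (p. 400)] -/
theorem X1.missingUpperBoundAt_of_classX1 (hW : sha_dvd_analyticSha)
    (hGZK : rank_eq_analyticRank_of_analyticRank_le_one) (hmod : hasEntireLFunction_rat)
    (W : WeierstrassCurve ℚ) [W.IsElliptic] [W.IsGloballyMinimal] (p : ℕ) [Fact p.Prime]
    (hX : ClassX1 W p) (h0 : W.analyticRank = 0) : MissingUpperBoundAt W p :=
  missingUpperBoundAt_of_wuthrich W p hW hGZK hmod (isClassX1_of_classX1 hX).two_ne h0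
    (isClassX1_of_classX1 hX).not_hasAdditiveReduction
    (Or.inl (isClassX1_of_classX1 hX).not_hasIrreducibleModPGaloisRep)

/-- **X1 conditional class theorem (canonical shape).** For `E/ℚ` (globally minimal `W`) with
`ord_{s=1} L(E,s) ≤ 1` and `(E,p)` in class X1, the typed missing input at `(E,p)` yields Miller's
`BSD(E,p)`: in analytic rank `0` the published upper half is Wuthrich's Prop. 21 (`hW`) and the missing
lower half is `hmiss.1`; in analytic rank `1` everything is `hmiss.2`. Standing named facts:
Gross–Zagier–Kolyvagin (`hGZK`), modularity (`hmod`). [cite: Wuthrich2014, Prop. 21 (p. 400)]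
[cite: Miller2011LMS, §1 and Def. 1.1] -/
theorem X1.bsdp_of_missingInputAt (hW : sha_dvd_analyticSha)
    (hGZK : rank_eq_analyticRank_of_analyticRank_le_one) (hmod : hasEntireLFunction_rat)
    (W : WeierstrassCurve ℚ) [W.IsElliptic] [W.IsGloballyMinimal] (p : ℕ) [Fact p.Prime]
    (hr : W.analyticRank ≤ 1) (hX : ClassX1 W p) (hmiss : X1.MissingInputAt W p) : BSDp W p := by
  rcases Nat.le_one_iff_eq_zero_or_eq_one.mp hr with h0 | h1
  · have hX' := isClassX1_of_classX1 hX
    exact bsdp_of_missingLowerBoundAt_of_wuthrich W p hW hGZK hmod hX'.two_ne h0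
      hX'.not_hasAdditiveReduction (Or.inl hX'.not_hasIrreducibleModPGaloisRep) (hmiss.1 h0)
  · exact bsdp_of_missingPPartAt W p hGZK hr (hmiss.2 h1)

/-- **X1, rank 0: the missing lower bound is DISCHARGED IN PRINT wherever the isogeny class contains a
curve with `p ∤ #Ш_an`.** If `E ∼ E'` over `ℚ` (globally minimal models), `(E',p)` is of class X1,
`L(E,1) ≠ 0`, and `#Ш(E'/ℚ)_an` is a rational of `p`-adic valuation `0`, then `MissingLowerBoundAt W p`
holds — indeed the whole `BSD(E,p)` does (`bsdp_of_classX1_of_L_one_ne_zero_of_isIsogenous`: Wuthrich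
Prop. 21 for `E'` + Cassels' isogeny invariance `hCassels` + Gross–Zagier–Kolyvagin). On the census
(N < 10⁴) this covers every rank-`0` X1 pair, so `X1.MissingInputAt` has EMPTY rank-`0` content there.
[cite: Wuthrich2014, Prop. 21 (p. 400)] [cite: MilneADT2006, Thm. I.7.3] -/
theorem X1.missingLowerBoundAt_of_isIsogenous (hW : sha_dvd_analyticSha)
    (hGZK : rank_eq_analyticRank_of_analyticRank_le_one) (hCassels : bsdRHS_eq_of_isIsogenous)
    (W W' : WeierstrassCurve ℚ) [W.IsElliptic] [W'.IsElliptic] [W.IsGloballyMinimal]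
    [W'.IsGloballyMinimal] (hiso : IsIsogenous W W') (p : ℕ) [Fact p.Prime]
    (hX' : ClassX1 W' p) (hL : W.entireLFunction 1 ≠ 0)
    (hunit' : ∃ q : ℚ, shaAn W' = (q : ℂ) ∧ padicValRat p q = 0) : MissingLowerBoundAt W p := by
  have hr0 : W.analyticRank = 0 := analyticRank_eq_zero_of_entireLFunction_one_ne_zero W hL
  haveI : Finite W.sha := (hGZK W (by rw [hr0]; exact zero_le_one)).2
  exact (lower_and_upper_of_missingPPartAt W p (missingPPartAt_of_bsdp W p
    (bsdp_of_classX1_of_L_one_ne_zero_of_isIsogenous hW hGZK hCassels W W' hiso p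
      (by rw [hr0]; exact zero_le_one) hX' hL hunit'))).1

end Literature.NumberTheory.EllipticCurves.Rank1Residual.Typed

end
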